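import Literature.NumberTheory.GaloisRepresentations.CyclotomicTowerLocalIndex
import Literature.GroupTheory.PadicIntCompactImageProofs
import Literature.NumberTheory.EllipticCurves.Sha
import HarnessLib

/-!
# In a `ℤ_p`-tower the decomposition group at a finite place COVERS every deep enough layer:
# `κ(Γ_{K_v}) ⊇ κ(Γ_n)` for `n ≥ n₀(v)` (Serre II §4.4 Lemme 1; Greenberg LNM 1716 §1)

Topic `NumberTheory/GaloisRepresentations`; namespace `Literature.NumberTheory.GaloisRepresentations`. THEOREMS ONLY
(no definition, no named fact, no instance, no `sorry`). Sequel to `CyclotomicTowerLocalIndex.lean` (`κ ∘ res_v` is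
non-trivial at every finite `v` for the cyclotomic `ℤ_p`-extension) and `Literature/GroupTheory/PadicIntCompactImageProofs.lean`
(a compact group maps onto `0` or onto some `p^e ℤ_p`).

For a `ℤ_p`-extension `κ : Γ_K →ₜ* ℤ_p` (`ZpExtension`, layers `Γ_n = κ⁻¹(p^n ℤ_p) = Gal(K̄/K_n)`) and a continuous
homomorphism `θ : D → Γ_K` from a compact group on which `κ` is NOT trivial, the image `κ(θ(D))` is a non-trivial closed
subgroup of `ℤ_p`, i.e. `p^{n₀} ℤ_p` for some `n₀`; hence it contains `κ(Γ_n) = p^n ℤ_p ∩ κ(Γ_K)` for every `n ≥ n₀`: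

* `exists_forall_layerSubgroup_exists_apply_eq_of_compactSpace` — **`∃ n₀, ∀ n ≥ n₀, ∀ u ∈ Γ_n, ∃ t : D, κ(θ t) = κ(u)`**;
* `exists_forall_layerSubgroup_exists_apply_absGaloisRestrict_eq` / `…_resGalOfEmb_eq` — the case `θ = res_v : Γ_{K_v} → Γ_K`
  (`absGaloisRestrict K K_v`, definitionally the tree's `resGalOfEmb (closureEmb K_v)`) at a finite place `v` of a number
  field where `κ ∘ res_v ≠ 1`; `…_of_isCyclotomic` — for the CYCLOTOMIC `ℤ_p`-extension this holds at EVERY finite `v`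
  (`exists_apply_resGal_ne_one_of_isCyclotomic'`: no finite place splits completely in `K_∞`).

In words: the place `v` is FINITELY decomposed in `K_∞` (`p^{n₀(v)}` primes above it), and from the layer `n₀(v)` on, every
coset of `Γ_{n+1}` in `Γ_n` meets the decomposition group — the hypothesis `hsurj` of the one-coset localisation formula
for Kato's layer trace maps (`forall_exists_layer_of_surjective` / `map_resGalSubgroupOfEmb_layerCores` of
`Summits/BirchSwinnertonDyer/…/ThetaPartnerAtTwoSignedKatoUpToAtTwoLocalCoresCompat.lean`), at the places `w ∤ p` of `S₀`
(crux RSL_g `ResidualSignedLambdaLowerCMAtTwo`, K-d / STUB-PLAN rev 13 S51: `hsurj_w`). At `v ∣ p` for the cyclotomic tower of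
`ℚ` one has `n₀ = 0` (`ZpExtension.IsCyclotomic.exists_apply_resGalOfEmb_adicCompletion_eq`, total ramification).

## References
* J.-P. Serre, *Cohomologie galoisienne* / *Galois Cohomology* (1997), I §1.4 (closed subgroups of `ℤ_p`), II §4.4 Lemme 1.
  [SerreGaloisCohomology1997]
* R. Greenberg, *Iwasawa theory for elliptic curves*, LNM 1716 (1999), §1 ("every non-archimedean prime is finitely
  decomposed in `F_∞`"). [GreenbergLNM1716]
* L. Washington, *Introduction to Cyclotomic Fields* (1997), §13.1. [Washington1997]
-/

noncomputable section

open Function Topology Field Multiplicative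

universe u

namespace Literature.NumberTheory.GaloisRepresentations

open Literature.NumberTheory.EllipticCurves

/-! ## §1 Abstract: a compact group on which `κ` is non-trivial covers the deep layers -/

/-- **A compact group on which `κ` is non-trivial covers every deep enough layer of the `ℤ_p`-tower**: for a `ℤ_p`-extension
`κ` of a field `K`, a compact group `D` and a continuous `θ : D → Γ_K` with `κ ∘ θ ≠ 1`, there is `n₀` such that for all
`n ≥ n₀` every `u ∈ Γ_n = κ⁻¹(p^n ℤ_p)` has `κ(u) = κ(θ t)` for some `t ∈ D` (the image `κ(θ(D))` is the closed subgroup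
`p^{n₀} ℤ_p`, tree `kappa_eq_one_or_exists_image_eq_span_pow`). [cite: SerreGaloisCohomology1997, I §1.4 and II §4.4 (Lemme 1)] -/
theorem exists_forall_layerSubgroup_exists_apply_eq_of_compactSpace {K : Type u} [Field K] {p : ℕ} [Fact p.Prime]
    (κ : ZpExtension K p) {D : Type*} [Group D] [TopologicalSpace D] [CompactSpace D]
    (θ : D →ₜ* absoluteGaloisGroup K) (hne : ∃ d : D, κ (θ d) ≠ 1) :
    ∃ n₀ : ℕ, ∀ n, n₀ ≤ n → ∀ u ∈ κ.layerSubgroup n, ∃ t : D, κ (θ t) = κ u := by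
  rcases Literature.GroupTheory.kappa_eq_one_or_exists_image_eq_span_pow (κ.toContinuousMonoidHom.comp θ) with
    htriv | ⟨e, -, hsurj⟩
  · obtain ⟨d, hd⟩ := hne
    exact absurd (htriv d) hd
  · refine ⟨e, fun n hn u hu ↦ ?_⟩
    have hu' : toAdd (κ u) ∈ Ideal.span {(p : ℤ_[p]) ^ e} := by
      rw [Ideal.mem_span_singleton]
      exact (pow_dvd_pow _ hn).trans (ZpExtension.mem_layerSubgroup.mp hu)
    obtain ⟨t, ht⟩ := hsurj _ hu'
    exact ⟨t, toAdd.injective ht⟩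

/-! ## §2 Number fields: the decomposition group at a finite place -/

section NumberField

open NumberField IsDedekindDomain

variable (K : Type) [Field K] [NumberField K] (p : ℕ) [Fact p.Prime]

/-- **The decomposition group at `v` covers the deep layers** (`absGaloisRestrict` dialect): for a `ℤ_p`-extension `κ` of a
number field `K` and a finite place `v` at which `κ ∘ res_v` is non-trivial (`v` does not split completely in `K_∞`), there is
`n₀` with `∀ n ≥ n₀, ∀ u ∈ Γ_n, ∃ t ∈ Γ_{K_v}, κ(res_v t) = κ(u)`. [cite: SerreGaloisCohomology1997, II §4.4 (Lemme 1)]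
[cite: GreenbergLNM1716, §1] -/
theorem exists_forall_layerSubgroup_exists_apply_absGaloisRestrict_eq (κ : ZpExtension K p)
    (v : HeightOneSpectrum (𝓞 K))
    (hne : ∃ σ : absoluteGaloisGroup (v.adicCompletion K), κ (absGaloisRestrict K (v.adicCompletion K) σ) ≠ 1) :
    ∃ n₀ : ℕ, ∀ n, n₀ ≤ n → ∀ u ∈ κ.layerSubgroup n,
      ∃ t : absoluteGaloisGroup (v.adicCompletion K), κ (absGaloisRestrict K (v.adicCompletion K) t) = κ u := by
  haveI := absoluteGaloisGroup_compactSpace (v.adicCompletion K)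
  exact exists_forall_layerSubgroup_exists_apply_eq_of_compactSpace κ (absGaloisRestrict K (v.adicCompletion K)) hne

/-- **The same in the `resGalOfEmb (closureEmb K_v)` dialect** of the tree's local layer groups (`localSubgroupOfEmb`,
`resGalSubgroupOfEmb`; the two restriction maps `Γ_{K_v} → Γ_K` agree definitionally): `κ ∘ res_v ≠ 1` ⟹
`∃ n₀, ∀ n ≥ n₀, ∀ u ∈ Γ_n, ∃ t, κ(resGalOfEmb (closureEmb K_v) t) = κ(u)` — the hypothesis `hsurj` of
`forall_exists_layer_of_surjective` from the layer `n₀` on. [cite: SerreGaloisCohomology1997, II §4.4 (Lemme 1)]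
[cite: GreenbergLNM1716, §1] -/
theorem exists_forall_layerSubgroup_exists_apply_resGalOfEmb_eq (κ : ZpExtension K p)
    (v : HeightOneSpectrum (𝓞 K))
    (hne : ∃ σ : absoluteGaloisGroup (v.adicCompletion K),
      κ (resGalOfEmb (closureEmb (K := K) (v.adicCompletion K)) σ) ≠ 1) :
    ∃ n₀ : ℕ, ∀ n, n₀ ≤ n → ∀ u ∈ κ.layerSubgroup n,
      ∃ t : absoluteGaloisGroup (v.adicCompletion K), κ (resGalOfEmb (closureEmb (K := K) (v.adicCompletion K)) t) = κ u := by
  haveI := absoluteGaloisGroup_compactSpace (v.adicCompletion K)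
  exact exists_forall_layerSubgroup_exists_apply_eq_of_compactSpace κ (resGalOfEmb (closureEmb (K := K) (v.adicCompletion K))) hne

/-- **Cyclotomic tower, every finite place** (`absGaloisRestrict` dialect): for the cyclotomic `ℤ_p`-extension `κ` of a number
field `K` and EVERY finite place `v` there is `n₀(v)` with `∀ n ≥ n₀(v), ∀ u ∈ Γ_n, ∃ t ∈ Γ_{K_v}, κ(res_v t) = κ(u)`
(`κ ∘ res_v ≠ 1`: `exists_apply_resGal_ne_one_of_isCyclotomic'` — no finite place splits completely in `K_∞`; Greenberg:
"`v` is finitely decomposed in `F_∞`"). [cite: GreenbergLNM1716, §1] [cite: Washington1997, §13.1]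
[cite: SerreGaloisCohomology1997, II §4.4 (Lemme 1)] -/
theorem exists_forall_layerSubgroup_exists_apply_absGaloisRestrict_eq_of_isCyclotomic {κ : ZpExtension K p}
    (hκ : κ.IsCyclotomic) (v : HeightOneSpectrum (𝓞 K)) :
    ∃ n₀ : ℕ, ∀ n, n₀ ≤ n → ∀ u ∈ κ.layerSubgroup n,
      ∃ t : absoluteGaloisGroup (v.adicCompletion K), κ (absGaloisRestrict K (v.adicCompletion K) t) = κ u :=
  exists_forall_layerSubgroup_exists_apply_absGaloisRestrict_eq K p κ v (exists_apply_resGal_ne_one_of_isCyclotomic' K p hκ v)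

/-- **Cyclotomic tower, every finite place, `resGalOfEmb (closureEmb K_v)` dialect**: for the cyclotomic `ℤ_p`-extension `κ`
of a number field `K` and every finite place `v`, `∃ n₀, ∀ n ≥ n₀, ∀ u ∈ Γ_n, ∃ t, κ(resGalOfEmb (closureEmb K_v) t) = κ(u)`
— the hypothesis `hsurj` of the one-coset localisation of Kato's layer trace maps at `v ∤ p`, from the layer `n₀(v)` on (at
`v ∣ p` over `ℚ`, `n₀ = 0`: `ZpExtension.IsCyclotomic.exists_apply_resGalOfEmb_adicCompletion_eq`).
[cite: GreenbergLNM1716, §1] [cite: Washington1997, §13.1] [cite: SerreGaloisCohomology1997, II §4.4 (Lemme 1)] -/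
theorem exists_forall_layerSubgroup_exists_apply_resGalOfEmb_eq_of_isCyclotomic {κ : ZpExtension K p}
    (hκ : κ.IsCyclotomic) (v : HeightOneSpectrum (𝓞 K)) :
    ∃ n₀ : ℕ, ∀ n, n₀ ≤ n → ∀ u ∈ κ.layerSubgroup n,
      ∃ t : absoluteGaloisGroup (v.adicCompletion K), κ (resGalOfEmb (closureEmb (K := K) (v.adicCompletion K)) t) = κ u :=
  exists_forall_layerSubgroup_exists_apply_resGalOfEmb_eq K p κ v (exists_apply_resGal_ne_one_of_isCyclotomic' K p hκ v)

end NumberField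

end Literature.NumberTheory.GaloisRepresentations

end
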